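import Literature.Barriers.CriticalPhenomena.GridSAWTiledDrawing
import Literature.Barriers.CriticalPhenomena.GridSAWStructuredDrawingBlocks
import HarnessLib

/-!
# Tiled grid drawings on an explicit vertex list

`GridSAWTiledDrawing.lean` assembles a named grid drawing from placed tiles on the vertex names
`0, …, nV - 1` (`assemble`, `assemble_isValid`). The graph to be drawn for
`GridSAW.LOT2003_lemma4_gadgets` (Liśkiewicz–Ogihara–Toda 2003, Lemma 4 / Theorem 7, the embedding
`E₀`), `Literature.Combinatorics.SimpleGraph.GridFormula.graphOf ψ`, has SPARSE names (cells at
`17 k + …`, gadget blocks at `17 · ncells + 64 g + …`, with holes), and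
`LOT2003_lemma4_gadgets_of_drawings` (`GridSAWStructuredDrawingBlocks.lean`) takes a drawing on any
list of names. This file is the variant of the assembly on an explicit vertex list:

* `assembleOn L verts gpos`, `TilingHypsOn` (as `TilingHyps` with `ν i ∈ verts` and the covering
  quantified over `verts`), **`assembleOn_isValid`** (the proof of `assemble_isValid`, verbatim up
  to the vertex list);
* `mem_assembleOn_edges`, **`assembleOn_graph_adj_iff`** (adjacency of the drawn graph: some placed
  tile edge joins the two names), `degree_assembleOn`;
* **`exists_box_of_mem_points_assembleOn`** — every point of the assembled drawing lies in the box
  of a placed tile (the input `inBox` of the outer returns, `GridSAWOuterReturns.lean`);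
* the WEAK tile check `Tile.ValidW` (= `Tile.Valid` without "no edge has both ends on the
  boundary", still decidable) and **`assembleOn_isValidW`**: with weakly valid tiles the assembled
  drawing is valid as soon as, globally, no two placed edges have the same pair of ends
  (`TilingHypsOnW.simple` — for the drawing of `graphOf ψ` this is part of the edge accounting
  against `edgesOf ψ`). The weak check admits rails of a gadget running ALONG a tile boundary
  (consecutive rail nodes shared with the tile below), which the clause row of the drawing needs.

## References

* M. Liśkiewicz, M. Ogihara, S. Toda, TCS 304 (2003) 129–156, §4 (proof of Theorem 7, `E₀`).
-/

namespace Literature.Barriers.CriticalPhenomena.GridSAW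

/-- **The drawing assembled from placed tiles on the vertex list `verts`**: the listed names at
`gpos`, all the placed edges. [cite: LiskiewiczOgiharaToda2003, §4 (proof of Theorem 7, E₀)] -/
def assembleOn (L : List Placement) (verts : List ℕ) (gpos : ℕ → GridPoint) : SDrawing ℕ where
  verts := verts
  pos := gpos
  edges := L.flatMap Placement.gedges

/-- Members of the assembled edge list. [folklore] -/
theorem mem_assembleOn_edges {L : List Placement} {verts : List ℕ} {gpos : ℕ → GridPoint} {d : SEdge ℕ} :
    d ∈ (assembleOn L verts gpos).edges ↔ ∃ P ∈ L, ∃ e ∈ P.T.edges, d = (P.ν e.1, P.ν e.2.1, e.2.2.map P.shift) := by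
  unfold assembleOn
  rw [List.mem_flatMap]
  constructor
  · rintro ⟨P, hP, hd⟩; exact ⟨P, hP, (P.mem_gedges_iff).1 hd⟩
  · rintro ⟨P, hP, h⟩; exact ⟨P, hP, (P.mem_gedges_iff).2 h⟩

/-- The edges of `assembleOn` are those of `assemble`. [folklore] -/
theorem assembleOn_edges (L : List Placement) (verts : List ℕ) (gpos : ℕ → GridPoint) (nV : ℕ) :
    (assembleOn L verts gpos).edges = (assemble L nV gpos).edges := rfl

section assembleOn

variable {L : List Placement} {verts : List ℕ} {gpos : ℕ → GridPoint}

/-- The hypotheses on a tiling over an explicit vertex list (cf. `TilingHyps`). [folklore] -/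
structure TilingHypsOn (L : List Placement) (verts : List ℕ) (gpos : ℕ → GridPoint) : Prop where
  /-- no placement listed twice -/
  nodup : L.Nodup
  /-- no name listed twice -/
  nodup_verts : verts.Nodup
  /-- every tile is valid -/
  valid : ∀ P ∈ L, P.T.Valid
  /-- local vertices are listed global vertices at the translated positions -/
  pos_eq : ∀ P ∈ L, ∀ i (hi : i < P.T.nv), P.ν i ∈ verts ∧ gpos (P.ν i) = P.shift P.T.pos[i]
  /-- distinct tiles meet only along their boundaries, and there one of the two is restricted -/
  boxes : ∀ P ∈ L, ∀ Q ∈ L, P ≠ Q → ∀ q, P.Box q → Q.Box q → (P.Bdry q ∧ Q.Bdry q) ∧ (P.RestrG q ∨ Q.RestrG q)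
  /-- a vertex of a tile lying in another tile's box is a vertex of that tile too -/
  crosslist : ∀ P ∈ L, ∀ Q ∈ L, ∀ j (hj : j < Q.T.nv), P.Box (Q.shift Q.T.pos[j]) →
    ∃ i, ∃ hi : i < P.T.nv, P.shift P.T.pos[i] = Q.shift Q.T.pos[j]
  /-- coinciding positions are the same global vertex -/
  shared : ∀ P ∈ L, ∀ Q ∈ L, ∀ i (hi : i < P.T.nv), ∀ j (hj : j < Q.T.nv),
    P.shift P.T.pos[i] = Q.shift Q.T.pos[j] → P.ν i = Q.ν j
  /-- every listed vertex is placed -/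
  cover : ∀ v ∈ verts, ∃ P ∈ L, ∃ i, i < P.T.nv ∧ P.ν i = v
  /-- global degrees -/
  degree : ∀ v ∈ verts, (assembleOn L verts gpos).degree v ≤ 3

/-- The global names of a placement are injective on its local vertices. [folklore] -/
theorem TilingHypsOn.ν_inj (H : TilingHypsOn L verts gpos) {P : Placement} (hP : P ∈ L) {i j : ℕ}
    (hi : i < P.T.nv) (hj : j < P.T.nv) (h : P.ν i = P.ν j) : i = j := by
  have h1 := (H.pos_eq P hP i hi).2
  have h2 := (H.pos_eq P hP j hj).2
  rw [h] at h1
  have := P.shift_injective (h1.symm.trans h2)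
  exact (List.Nodup.getElem_inj_iff (H.valid P hP).2.1).1 this

/-- A path point of a placed edge that is a global vertex position is a local vertex position of
the same tile (cf. `TilingHyps.mem_pos_of_point`). [folklore] -/
theorem TilingHypsOn.mem_pos_of_point (H : TilingHypsOn L verts gpos) {P : Placement} (hP : P ∈ L)
    {e : ℕ × ℕ × List GridPoint} (he : e ∈ P.T.edges) {p : GridPoint} (hp : p ∈ e.2.2)
    {Q : Placement} (hQ : Q ∈ L) {j : ℕ} (hj : j < Q.T.nv) (heq : P.shift p = Q.shift Q.T.pos[j]) :
    p ∈ P.T.pos := by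
  have hT := H.valid P hP
  obtain ⟨hbox, -, -, -⟩ := (hT.edge he).2.2.2.2.2.2.2.1 p hp
  have hq1 : P.Box (Q.shift Q.T.pos[j]) := by rw [← heq]; exact P.box_shift.2 hbox
  obtain ⟨i, hi, hieq⟩ := H.crosslist P hP Q hQ j hj hq1
  rw [← heq] at hieq
  rw [← P.shift_injective hieq]
  exact List.getElem_mem hi

/-- A common point of edges of two distinct placed tiles is a local vertex position (cf.
`TilingHyps.mem_pos_of_common`). [folklore] -/
theorem TilingHypsOn.mem_pos_of_common (H : TilingHypsOn L verts gpos) {P Q : Placement} (hP : P ∈ L) (hQ : Q ∈ L)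
    (hPQ : P ≠ Q) {e e' : ℕ × ℕ × List GridPoint} (he : e ∈ P.T.edges) (he' : e' ∈ Q.T.edges)
    {p p' : GridPoint} (hp : p ∈ e.2.2) (hp' : p' ∈ e'.2.2) (heq : P.shift p = Q.shift p') : p ∈ P.T.pos := by
  obtain ⟨hbox, -, -, hbd⟩ := ((H.valid P hP).edge he).2.2.2.2.2.2.2.1 p hp
  obtain ⟨hbox', -, -, hbd'⟩ := ((H.valid Q hQ).edge he').2.2.2.2.2.2.2.1 p' hp'
  have hq1 : P.Box (P.shift p) := P.box_shift.2 hbox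
  have hq2 : Q.Box (P.shift p) := by rw [heq]; exact Q.box_shift.2 hbox'
  rcases (H.boxes P hP Q hQ hPQ _ hq1 hq2).2 with hr | hr
  · exact hbd (P.restrG_shift.1 hr)
  · have hp'pos : p' ∈ Q.T.pos := hbd' (Q.restrG_shift.1 (by rwa [heq] at hr))
    obtain ⟨j, hj, rfl⟩ := Tile.exists_getElem_of_mem hp'pos
    obtain ⟨i, hi, hieq⟩ := H.crosslist P hP Q hQ j hj (by rw [← heq]; exact hq1)
    rw [← heq] at hieq
    rw [← P.shift_injective hieq]
    exact List.getElem_mem hi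

/-- A local vertex position is a global vertex position. [folklore] -/
theorem TilingHypsOn.exists_vertex_of_mem_pos (H : TilingHypsOn L verts gpos) {P : Placement} (hP : P ∈ L)
    {p : GridPoint} (hp : p ∈ P.T.pos) :
    ∃ v ∈ (assembleOn L verts gpos).verts, (assembleOn L verts gpos).pos v = P.shift p := by
  obtain ⟨i, hi, rfl⟩ := Tile.exists_getElem_of_mem hp
  obtain ⟨hmem, hpos⟩ := H.pos_eq P hP i hi
  exact ⟨P.ν i, hmem, hpos⟩

/-- **The drawing assembled on a vertex list from a tiling satisfying the hypotheses is valid**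
(the proof of `assemble_isValid` on the vertex list). [cite: LiskiewiczOgiharaToda2003, §4 (proof of Theorem 7, E₀)] -/
theorem assembleOn_isValid (H : TilingHypsOn L verts gpos) : (assembleOn L verts gpos).IsValid := by
  have hverts : (assembleOn L verts gpos).verts = verts := rfl
  have hposf : (assembleOn L verts gpos).pos = gpos := rfl
  refine ⟨H.nodup_verts, ?_, ?_, ?_, ?_, ?_, ?_, ?_, ?_, ?_, ?_, ?_, fun v hv => H.degree v hv⟩
  · -- distinct vertices at distinct points
    intro a ha b hb hab
    rw [hverts] at ha hb
    obtain ⟨P, hP, i, hi, rfl⟩ := H.cover a ha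
    obtain ⟨Q, hQ, j, hj, rfl⟩ := H.cover b hb
    rw [hposf, (H.pos_eq P hP i hi).2, (H.pos_eq Q hQ j hj).2] at hab
    exact H.shared P hP Q hQ i hi j hj hab
  · -- first ends listed
    intro d hd
    obtain ⟨P, hP, e, he, rfl⟩ := mem_assembleOn_edges.1 hd
    exact (H.pos_eq P hP _ ((H.valid P hP).edge he).1).1
  · intro d hd
    obtain ⟨P, hP, e, he, rfl⟩ := mem_assembleOn_edges.1 hd
    exact (H.pos_eq P hP _ ((H.valid P hP).edge he).2.1).1
  · -- no loops
    intro d hd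
    obtain ⟨P, hP, e, he, rfl⟩ := mem_assembleOn_edges.1 hd
    have hv := (H.valid P hP).edge he
    intro h
    exact hv.2.2.1 (H.ν_inj hP hv.1 hv.2.1 h)
  · -- the path starts at the first end
    intro d hd
    obtain ⟨P, hP, e, he, rfl⟩ := mem_assembleOn_edges.1 hd
    have hv := (H.valid P hP).edge he
    show (e.2.2.map P.shift).head? = some (gpos (P.ν e.1))
    rw [List.head?_map, hv.2.2.2.1, List.getElem?_eq_getElem hv.1, Option.map_some, (H.pos_eq P hP _ hv.1).2]
  · intro d hd
    obtain ⟨P, hP, e, he, rfl⟩ := mem_assembleOn_edges.1 hd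
    have hv := (H.valid P hP).edge he
    show (e.2.2.map P.shift).getLast? = some (gpos (P.ν e.2.1))
    rw [List.getLast?_map, hv.2.2.2.2.1, List.getElem?_eq_getElem hv.2.1, Option.map_some, (H.pos_eq P hP _ hv.2.1).2]
  · -- self-avoiding
    intro d hd
    obtain ⟨P, hP, e, he, rfl⟩ := mem_assembleOn_edges.1 hd
    exact ((H.valid P hP).edge he).2.2.2.2.2.1.map P.shift_injective
  · -- grid paths
    intro d hd
    obtain ⟨P, hP, e, he, rfl⟩ := mem_assembleOn_edges.1 hd
    show List.IsChain IsGridEdge (e.2.2.map P.shift)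
    rw [List.isChain_map]
    exact ((H.valid P hP).edge he).2.2.2.2.2.2.1.imp fun a b h => P.isGridEdge_shift.2 h
  · -- paths meet vertex positions only at their ends
    intro d hd v hv hmem
    obtain ⟨P, hP, e, he, rfl⟩ := mem_assembleOn_edges.1 hd
    rw [hverts] at hv
    obtain ⟨Q, hQ, j, hj, rfl⟩ := H.cover v hv
    change gpos (Q.ν j) ∈ e.2.2.map P.shift at hmem
    rw [(H.pos_eq Q hQ j hj).2, List.mem_map] at hmem
    obtain ⟨p, hp, heq⟩ := hmem
    have hpos : p ∈ P.T.pos := H.mem_pos_of_point hP he hp hQ hj heq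
    have hT := H.valid P hP
    rcases hT.eq_end_of_mem he hp hpos with h | h
    · left
      show Q.ν j = P.ν e.1
      refine (H.shared P hP Q hQ _ (hT.edge he).1 j hj ?_).symm
      rw [h, heq]
    · right
      show Q.ν j = P.ν e.2.1
      refine (H.shared P hP Q hQ _ (hT.edge he).2.1 j hj ?_).symm
      rw [h, heq]
  · -- no parallel edges
    unfold assembleOn
    rw [List.pairwise_flatMap]
    constructor
    · intro P hP
      unfold Placement.gedges
      rw [List.pairwise_map]
      have hT := H.valid P hP
      refine hT.2.2.2.1.imp_of_mem fun {e e'} he he' hne => ?_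
      unfold SDrawing.SameEndsS
      simp only
      rintro (⟨h1, h2⟩ | ⟨h1, h2⟩)
      · exact hne (Or.inl ⟨H.ν_inj hP (hT.edge he).1 (hT.edge he').1 h1, H.ν_inj hP (hT.edge he).2.1 (hT.edge he').2.1 h2⟩)
      · exact hne (Or.inr ⟨H.ν_inj hP (hT.edge he).1 (hT.edge he').2.1 h1, H.ν_inj hP (hT.edge he).2.1 (hT.edge he').1 h2⟩)
    · refine List.Pairwise.imp_of_mem ?_ H.nodup
      intro P Q hP hQ hPQ d hd d' hd' hsame
      obtain ⟨e, he, rfl⟩ := P.mem_gedges_iff.1 hd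
      obtain ⟨e', he', rfl⟩ := Q.mem_gedges_iff.1 hd'
      have hT := H.valid P hP
      have hv := hT.edge he
      have hv' := (H.valid Q hQ).edge he'
      apply hv.2.2.2.2.2.2.2.2
      have key : ∀ {i j : ℕ} (hi : i < P.T.nv) (hj : j < Q.T.nv), P.ν i = Q.ν j →
          ∀ p ∈ P.T.pos[i]?, P.T.OnBdry p := by
        intro i j hi hj hij p hp
        rw [List.getElem?_eq_getElem hi, Option.mem_def, Option.some.injEq] at hp
        subst hp
        have h1 := (H.pos_eq P hP i hi).2
        have h2 := (H.pos_eq Q hQ j hj).2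
        rw [hij] at h1
        have heq := h1.symm.trans h2
        have hq1 : P.Box (P.shift P.T.pos[i]) := P.box_shift.2 (hT.1 _ (List.getElem_mem hi)).1
        have hq2 : Q.Box (P.shift P.T.pos[i]) := by
          rw [heq]; exact Q.box_shift.2 ((H.valid Q hQ).1 _ (List.getElem_mem hj)).1
        exact P.bdry_shift.1 (H.boxes P hP Q hQ hPQ _ hq1 hq2).1.1
      unfold SDrawing.SameEndsS at hsame
      simp only at hsame
      rcases hsame with ⟨h1, h2⟩ | ⟨h1, h2⟩
      · exact ⟨key hv.1 hv'.1 h1, key hv.2.1 hv'.2.1 h2⟩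
      · exact ⟨key hv.1 hv'.2.1 h1, key hv.2.1 hv'.1 h2⟩
  · -- congestion-free
    unfold assembleOn
    rw [List.pairwise_flatMap]
    constructor
    · intro P hP
      unfold Placement.gedges
      rw [List.pairwise_map]
      have hT := H.valid P hP
      refine hT.pairwise_common.imp_of_mem fun {e e'} he he' hcommon q hq hq' => ?_
      simp only [List.mem_map] at hq hq'
      obtain ⟨p, hp, rfl⟩ := hq
      obtain ⟨p', hp', heq⟩ := hq'
      rw [P.shift_injective heq] at hp'
      exact H.exists_vertex_of_mem_pos hP (hcommon p hp hp')
    · refine List.Pairwise.imp_of_mem ?_ H.nodup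
      intro P Q hP hQ hPQ d hd d' hd' q hq hq'
      obtain ⟨e, he, rfl⟩ := P.mem_gedges_iff.1 hd
      obtain ⟨e', he', rfl⟩ := Q.mem_gedges_iff.1 hd'
      simp only [List.mem_map] at hq hq'
      obtain ⟨p, hp, rfl⟩ := hq
      obtain ⟨p', hp', heq⟩ := hq'
      exact H.exists_vertex_of_mem_pos hP (H.mem_pos_of_common hP hQ hPQ he he' hp hp' heq.symm)

end assembleOn

/-! ### Degrees, adjacency, points -/

/-- The degree in the assembled drawing is the sum of the degrees in the placed tiles. [folklore] -/
theorem degree_assembleOn (L : List Placement) (verts : List ℕ) (gpos : ℕ → GridPoint) (v : ℕ) :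
    (assembleOn L verts gpos).degree v = (L.map fun P => P.gedges.countP fun e => decide (e.1 = v ∨ e.2.1 = v)).sum := by
  unfold SDrawing.degree assembleOn
  simp only
  rw [List.countP_flatMap]
  rfl

/-- **Adjacency of the graph drawn by the assembled drawing**: some placed tile edge joins the two
(distinct) names. [folklore] -/
theorem assembleOn_graph_adj_iff (L : List Placement) (verts : List ℕ) (gpos : ℕ → GridPoint) {a b : ℕ} :
    (assembleOn L verts gpos).graph.Adj a b ↔
      a ≠ b ∧ ∃ P ∈ L, ∃ e ∈ P.T.edges, (P.ν e.1 = a ∧ P.ν e.2.1 = b) ∨ (P.ν e.1 = b ∧ P.ν e.2.1 = a) := by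
  rw [SDrawing.graph_adj_iff]
  refine and_congr_right fun _ => ?_
  constructor
  · rintro ⟨d, hd, h⟩
    obtain ⟨P, hP, e, he, rfl⟩ := mem_assembleOn_edges.1 hd
    exact ⟨P, hP, e, he, h⟩
  · rintro ⟨P, hP, e, he, h⟩
    exact ⟨_, mem_assembleOn_edges.2 ⟨P, hP, e, he, rfl⟩, h⟩

/-- **Every point of the assembled drawing lies in the box of a placed tile** (vertex images by the
covering, path points by tile validity). [folklore] -/
theorem exists_box_of_mem_points_assembleOn {L : List Placement} {verts : List ℕ} {gpos : ℕ → GridPoint}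
    (H : TilingHypsOn L verts gpos) {p : GridPoint} (hp : p ∈ (assembleOn L verts gpos).points) :
    ∃ P ∈ L, P.Box p := by
  rcases (SDrawing.mem_points_iff _).1 hp with ⟨v, hv, rfl⟩ | ⟨d, hd, hpd⟩
  · obtain ⟨P, hP, i, hi, rfl⟩ := H.cover v hv
    refine ⟨P, hP, ?_⟩
    show P.Box (gpos (P.ν i))
    rw [(H.pos_eq P hP i hi).2]
    exact P.box_shift.2 ((H.valid P hP).1 _ (List.getElem_mem hi)).1
  · obtain ⟨P, hP, e, he, rfl⟩ := mem_assembleOn_edges.1 hd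
    obtain ⟨q, hq, rfl⟩ := List.mem_map.1 hpd
    exact ⟨P, hP, P.box_shift.2 (((H.valid P hP).edge he).2.2.2.2.2.2.2.1 q hq).1⟩

/-- The box of a placed tile, in coordinates. [folklore] -/
theorem Placement.box_iff (P : Placement) {q : GridPoint} :
    P.Box q ↔ P.o.1 ≤ q.1 ∧ q.1 ≤ P.o.1 + P.T.w ∧ P.o.2 ≤ q.2 ∧ q.2 ≤ P.o.2 + P.T.h := by
  unfold Placement.Box Tile.InBox
  simp only
  omega


/-! ### Weakly valid tiles and global simplicity -/

namespace Tile

variable (T : Tile)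

/-- The conditions on one local edge of a WEAKLY valid tile: `EdgeOK` without "not both ends on
the boundary" (the path clause last). [folklore] -/
def EdgeOKW (e : ℕ × ℕ × List GridPoint) : Prop :=
  e.1 < T.nv ∧ e.2.1 < T.nv ∧ e.1 ≠ e.2.1 ∧
    e.2.2.head? = T.pos[e.1]? ∧ e.2.2.getLast? = T.pos[e.2.1]? ∧ e.2.2.Nodup ∧
    List.IsChain IsGridEdge e.2.2 ∧
    (∀ p ∈ e.2.2, T.InBox p ∧ ¬ T.IsCorner p ∧ (p ∈ T.pos → T.pos[e.1]? = some p ∨ T.pos[e.2.1]? = some p) ∧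
      (T.Restr p → p ∈ T.pos))

/-- The weak edge conditions are decidable. [folklore] -/
instance (e : ℕ × ℕ × List GridPoint) : Decidable (T.EdgeOKW e) := by unfold EdgeOKW; infer_instance

/-- **Weak validity of a tile**: `Valid` with `EdgeOKW` for `EdgeOK` (edges with both ends on the
boundary allowed; global simplicity is then a hypothesis of the assembly). [folklore] -/
def ValidW (T : Tile) : Prop :=
  (∀ p ∈ T.pos, T.InBox p ∧ ¬ T.IsCorner p) ∧
  T.pos.Nodup ∧
  (∀ e ∈ T.edges, T.EdgeOKW e) ∧
  T.edges.Pairwise (fun e e' => ¬ ((e.1 = e'.1 ∧ e.2.1 = e'.2.1) ∨ (e.1 = e'.2.1 ∧ e.2.1 = e'.1))) ∧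
  bitNodup T.interiorKeys 0 = true ∧
  (∀ i < T.nv, T.ldeg i ≤ T.bud.getD i 0 ∧ T.bud.getD i 0 ≤ 3)

/-- Weak validity is decidable (certified by `decide`, tile by tile). [folklore] -/
instance : Decidable T.ValidW := by unfold ValidW; infer_instance

variable {T}

/-- Valid tiles are weakly valid. [folklore] -/
theorem Valid.validW (h : T.Valid) : T.ValidW :=
  ⟨h.1, h.2.1, fun e he => let v := h.2.2.1 e he; ⟨v.1, v.2.1, v.2.2.1, v.2.2.2.1, v.2.2.2.2.1, v.2.2.2.2.2.1, v.2.2.2.2.2.2.1,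
    v.2.2.2.2.2.2.2.1⟩, h.2.2.2.1, h.2.2.2.2.1, h.2.2.2.2.2⟩

/-- Accessors of a weakly valid tile's edge conditions. [folklore] -/
theorem ValidW.edge (hT : T.ValidW) {e : ℕ × ℕ × List GridPoint} (he : e ∈ T.edges) :
    e.1 < T.nv ∧ e.2.1 < T.nv ∧ e.1 ≠ e.2.1 ∧
      e.2.2.head? = T.pos[e.1]? ∧ e.2.2.getLast? = T.pos[e.2.1]? ∧ e.2.2.Nodup ∧
      List.IsChain IsGridEdge e.2.2 ∧
      (∀ p ∈ e.2.2, T.InBox p ∧ ¬ T.IsCorner p ∧ (p ∈ T.pos → T.pos[e.1]? = some p ∨ T.pos[e.2.1]? = some p) ∧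
        (T.Restr p → p ∈ T.pos)) :=
  hT.2.2.1 e he

/-- In a weakly valid tile, a path point that is a vertex position is an end of the edge. [folklore] -/
theorem ValidW.eq_end_of_mem (hT : T.ValidW) {e : ℕ × ℕ × List GridPoint} (he : e ∈ T.edges) {p : GridPoint}
    (hp : p ∈ e.2.2) (hpos : p ∈ T.pos) :
    (T.pos[e.1]'(hT.edge he).1 = p) ∨ (T.pos[e.2.1]'(hT.edge he).2.1 = p) := by
  have h := ((hT.edge he).2.2.2.2.2.2.2 p hp).2.2.1 hpos
  simp only [List.getElem?_eq_getElem (hT.edge he).1, List.getElem?_eq_getElem (hT.edge he).2.1,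
    Option.some.injEq] at h
  exact h

/-- In a weakly valid tile, a common point of two edges is a vertex position. [folklore] -/
theorem ValidW.pairwise_common (hT : T.ValidW) :
    T.edges.Pairwise (fun e e' => ∀ p ∈ e.2.2, p ∈ e'.2.2 → p ∈ T.pos) := by
  have hnd : T.interiorKeys.Nodup := (nodup_of_bitNodup hT.2.2.2.2.1).1
  unfold interiorKeys at hnd
  rw [List.nodup_flatMap] at hnd
  refine hnd.2.imp fun {e e'} hdis p hp hp' => ?_
  by_contra hnot
  refine hdis ?_ ?_ (a := T.key p)
  · exact List.mem_map.2 ⟨p, List.mem_filter.2 ⟨hp, by simpa using hnot⟩, rfl⟩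
  · exact List.mem_map.2 ⟨p, List.mem_filter.2 ⟨hp', by simpa using hnot⟩, rfl⟩

/-- The local degree is within the budget (weak validity). [folklore] -/
theorem ValidW.ldeg_le (hT : T.ValidW) {i : ℕ} (hi : i < T.nv) : T.ldeg i ≤ T.bud.getD i 0 ∧ T.bud.getD i 0 ≤ 3 :=
  hT.2.2.2.2.2 i hi

end Tile

section assembleOnW

variable {L : List Placement} {verts : List ℕ} {gpos : ℕ → GridPoint}

/-- The hypotheses on a tiling by WEAKLY valid tiles: `TilingHypsOn` with `ValidW`, plus global
simplicity of the placed edges. [folklore] -/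
structure TilingHypsOnW (L : List Placement) (verts : List ℕ) (gpos : ℕ → GridPoint) : Prop where
  /-- no placement listed twice -/
  nodup : L.Nodup
  /-- no name listed twice -/
  nodup_verts : verts.Nodup
  /-- every tile is weakly valid -/
  valid : ∀ P ∈ L, P.T.ValidW
  /-- local vertices are listed global vertices at the translated positions -/
  pos_eq : ∀ P ∈ L, ∀ i (hi : i < P.T.nv), P.ν i ∈ verts ∧ gpos (P.ν i) = P.shift P.T.pos[i]
  /-- distinct tiles meet only along their boundaries, and there one of the two is restricted -/
  boxes : ∀ P ∈ L, ∀ Q ∈ L, P ≠ Q → ∀ q, P.Box q → Q.Box q → (P.Bdry q ∧ Q.Bdry q) ∧ (P.RestrG q ∨ Q.RestrG q)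
  /-- a vertex of a tile lying in another tile's box is a vertex of that tile too -/
  crosslist : ∀ P ∈ L, ∀ Q ∈ L, ∀ j (hj : j < Q.T.nv), P.Box (Q.shift Q.T.pos[j]) →
    ∃ i, ∃ hi : i < P.T.nv, P.shift P.T.pos[i] = Q.shift Q.T.pos[j]
  /-- coinciding positions are the same global vertex -/
  shared : ∀ P ∈ L, ∀ Q ∈ L, ∀ i (hi : i < P.T.nv), ∀ j (hj : j < Q.T.nv),
    P.shift P.T.pos[i] = Q.shift Q.T.pos[j] → P.ν i = Q.ν j
  /-- every listed vertex is placed -/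
  cover : ∀ v ∈ verts, ∃ P ∈ L, ∃ i, i < P.T.nv ∧ P.ν i = v
  /-- global degrees -/
  degree : ∀ v ∈ verts, (assembleOn L verts gpos).degree v ≤ 3
  /-- global simplicity: no two placed edges with the same ends -/
  simple : (assembleOn L verts gpos).edges.Pairwise fun e e' => ¬ SDrawing.SameEndsS e e'

/-- The global names of a placement are injective on its local vertices. [folklore] -/
theorem TilingHypsOnW.ν_inj (H : TilingHypsOnW L verts gpos) {P : Placement} (hP : P ∈ L) {i j : ℕ}
    (hi : i < P.T.nv) (hj : j < P.T.nv) (h : P.ν i = P.ν j) : i = j := by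
  have h1 := (H.pos_eq P hP i hi).2
  have h2 := (H.pos_eq P hP j hj).2
  rw [h] at h1
  have := P.shift_injective (h1.symm.trans h2)
  exact (List.Nodup.getElem_inj_iff (H.valid P hP).2.1).1 this

/-- A path point of a placed edge that is a global vertex position is a local vertex position of
the same tile (weak form). [folklore] -/
theorem TilingHypsOnW.mem_pos_of_point (H : TilingHypsOnW L verts gpos) {P : Placement} (hP : P ∈ L)
    {e : ℕ × ℕ × List GridPoint} (he : e ∈ P.T.edges) {p : GridPoint} (hp : p ∈ e.2.2)
    {Q : Placement} (hQ : Q ∈ L) {j : ℕ} (hj : j < Q.T.nv) (heq : P.shift p = Q.shift Q.T.pos[j]) :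
    p ∈ P.T.pos := by
  have hT := H.valid P hP
  obtain ⟨hbox, -, -, -⟩ := (hT.edge he).2.2.2.2.2.2.2 p hp
  have hq1 : P.Box (Q.shift Q.T.pos[j]) := by rw [← heq]; exact P.box_shift.2 hbox
  obtain ⟨i, hi, hieq⟩ := H.crosslist P hP Q hQ j hj hq1
  rw [← heq] at hieq
  rw [← P.shift_injective hieq]
  exact List.getElem_mem hi

/-- A common point of edges of two distinct placed tiles is a local vertex position (weak form).
[folklore] -/
theorem TilingHypsOnW.mem_pos_of_common (H : TilingHypsOnW L verts gpos) {P Q : Placement} (hP : P ∈ L) (hQ : Q ∈ L)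
    (hPQ : P ≠ Q) {e e' : ℕ × ℕ × List GridPoint} (he : e ∈ P.T.edges) (he' : e' ∈ Q.T.edges)
    {p p' : GridPoint} (hp : p ∈ e.2.2) (hp' : p' ∈ e'.2.2) (heq : P.shift p = Q.shift p') : p ∈ P.T.pos := by
  obtain ⟨hbox, -, -, hbd⟩ := ((H.valid P hP).edge he).2.2.2.2.2.2.2 p hp
  obtain ⟨hbox', -, -, hbd'⟩ := ((H.valid Q hQ).edge he').2.2.2.2.2.2.2 p' hp'
  have hq1 : P.Box (P.shift p) := P.box_shift.2 hbox
  have hq2 : Q.Box (P.shift p) := by rw [heq]; exact Q.box_shift.2 hbox'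
  rcases (H.boxes P hP Q hQ hPQ _ hq1 hq2).2 with hr | hr
  · exact hbd (P.restrG_shift.1 hr)
  · have hp'pos : p' ∈ Q.T.pos := hbd' (Q.restrG_shift.1 (by rwa [heq] at hr))
    obtain ⟨j, hj, rfl⟩ := Tile.exists_getElem_of_mem hp'pos
    obtain ⟨i, hi, hieq⟩ := H.crosslist P hP Q hQ j hj (by rw [← heq]; exact hq1)
    rw [← heq] at hieq
    rw [← P.shift_injective hieq]
    exact List.getElem_mem hi

/-- A local vertex position is a global vertex position (weak form). [folklore] -/
theorem TilingHypsOnW.exists_vertex_of_mem_pos (H : TilingHypsOnW L verts gpos) {P : Placement} (hP : P ∈ L)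
    {p : GridPoint} (hp : p ∈ P.T.pos) :
    ∃ v ∈ (assembleOn L verts gpos).verts, (assembleOn L verts gpos).pos v = P.shift p := by
  obtain ⟨i, hi, rfl⟩ := Tile.exists_getElem_of_mem hp
  obtain ⟨hmem, hpos⟩ := H.pos_eq P hP i hi
  exact ⟨P.ν i, hmem, hpos⟩

/-- **The drawing assembled on a vertex list from WEAKLY valid tiles is valid under global
simplicity.** [cite: LiskiewiczOgiharaToda2003, §4 (proof of Theorem 7, E₀)] -/
theorem assembleOn_isValidW (H : TilingHypsOnW L verts gpos) : (assembleOn L verts gpos).IsValid := by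
  have hverts : (assembleOn L verts gpos).verts = verts := rfl
  have hposf : (assembleOn L verts gpos).pos = gpos := rfl
  refine ⟨H.nodup_verts, ?_, ?_, ?_, ?_, ?_, ?_, ?_, ?_, ?_, H.simple, ?_, fun v hv => H.degree v hv⟩
  · intro a ha b hb hab
    rw [hverts] at ha hb
    obtain ⟨P, hP, i, hi, rfl⟩ := H.cover a ha
    obtain ⟨Q, hQ, j, hj, rfl⟩ := H.cover b hb
    rw [hposf, (H.pos_eq P hP i hi).2, (H.pos_eq Q hQ j hj).2] at hab
    exact H.shared P hP Q hQ i hi j hj hab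
  · intro d hd
    obtain ⟨P, hP, e, he, rfl⟩ := mem_assembleOn_edges.1 hd
    exact (H.pos_eq P hP _ ((H.valid P hP).edge he).1).1
  · intro d hd
    obtain ⟨P, hP, e, he, rfl⟩ := mem_assembleOn_edges.1 hd
    exact (H.pos_eq P hP _ ((H.valid P hP).edge he).2.1).1
  · intro d hd
    obtain ⟨P, hP, e, he, rfl⟩ := mem_assembleOn_edges.1 hd
    have hv := (H.valid P hP).edge he
    intro h
    exact hv.2.2.1 (H.ν_inj hP hv.1 hv.2.1 h)
  · intro d hd
    obtain ⟨P, hP, e, he, rfl⟩ := mem_assembleOn_edges.1 hd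
    have hv := (H.valid P hP).edge he
    show (e.2.2.map P.shift).head? = some (gpos (P.ν e.1))
    rw [List.head?_map, hv.2.2.2.1, List.getElem?_eq_getElem hv.1, Option.map_some, (H.pos_eq P hP _ hv.1).2]
  · intro d hd
    obtain ⟨P, hP, e, he, rfl⟩ := mem_assembleOn_edges.1 hd
    have hv := (H.valid P hP).edge he
    show (e.2.2.map P.shift).getLast? = some (gpos (P.ν e.2.1))
    rw [List.getLast?_map, hv.2.2.2.2.1, List.getElem?_eq_getElem hv.2.1, Option.map_some, (H.pos_eq P hP _ hv.2.1).2]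
  · intro d hd
    obtain ⟨P, hP, e, he, rfl⟩ := mem_assembleOn_edges.1 hd
    exact ((H.valid P hP).edge he).2.2.2.2.2.1.map P.shift_injective
  · intro d hd
    obtain ⟨P, hP, e, he, rfl⟩ := mem_assembleOn_edges.1 hd
    show List.IsChain IsGridEdge (e.2.2.map P.shift)
    rw [List.isChain_map]
    exact ((H.valid P hP).edge he).2.2.2.2.2.2.1.imp fun a b h => P.isGridEdge_shift.2 h
  · intro d hd v hv hmem
    obtain ⟨P, hP, e, he, rfl⟩ := mem_assembleOn_edges.1 hd
    rw [hverts] at hv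
    obtain ⟨Q, hQ, j, hj, rfl⟩ := H.cover v hv
    change gpos (Q.ν j) ∈ e.2.2.map P.shift at hmem
    rw [(H.pos_eq Q hQ j hj).2, List.mem_map] at hmem
    obtain ⟨p, hp, heq⟩ := hmem
    have hpos : p ∈ P.T.pos := H.mem_pos_of_point hP he hp hQ hj heq
    have hT := H.valid P hP
    rcases hT.eq_end_of_mem he hp hpos with h | h
    · left
      show Q.ν j = P.ν e.1
      refine (H.shared P hP Q hQ _ (hT.edge he).1 j hj ?_).symm
      rw [h, heq]
    · right
      show Q.ν j = P.ν e.2.1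
      refine (H.shared P hP Q hQ _ (hT.edge he).2.1 j hj ?_).symm
      rw [h, heq]
  · -- congestion-free
    unfold assembleOn
    rw [List.pairwise_flatMap]
    constructor
    · intro P hP
      unfold Placement.gedges
      rw [List.pairwise_map]
      have hT := H.valid P hP
      refine hT.pairwise_common.imp_of_mem fun {e e'} he he' hcommon q hq hq' => ?_
      simp only [List.mem_map] at hq hq'
      obtain ⟨p, hp, rfl⟩ := hq
      obtain ⟨p', hp', heq⟩ := hq'
      rw [P.shift_injective heq] at hp'
      exact H.exists_vertex_of_mem_pos hP (hcommon p hp hp')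
    · refine List.Pairwise.imp_of_mem ?_ H.nodup
      intro P Q hP hQ hPQ d hd d' hd' q hq hq'
      obtain ⟨e, he, rfl⟩ := P.mem_gedges_iff.1 hd
      obtain ⟨e', he', rfl⟩ := Q.mem_gedges_iff.1 hd'
      simp only [List.mem_map] at hq hq'
      obtain ⟨p, hp, rfl⟩ := hq
      obtain ⟨p', hp', heq⟩ := hq'
      exact H.exists_vertex_of_mem_pos hP (H.mem_pos_of_common hP hQ hPQ he he' hp hp' heq.symm)

/-- Every point of the assembled drawing lies in the box of a placed tile (weak form). [folklore] -/
theorem exists_box_of_mem_points_assembleOnW (H : TilingHypsOnW L verts gpos) {p : GridPoint}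
    (hp : p ∈ (assembleOn L verts gpos).points) : ∃ P ∈ L, P.Box p := by
  rcases (SDrawing.mem_points_iff _).1 hp with ⟨v, hv, rfl⟩ | ⟨d, hd, hpd⟩
  · obtain ⟨P, hP, i, hi, rfl⟩ := H.cover v hv
    refine ⟨P, hP, ?_⟩
    show P.Box (gpos (P.ν i))
    rw [(H.pos_eq P hP i hi).2]
    exact P.box_shift.2 ((H.valid P hP).1 _ (List.getElem_mem hi)).1
  · obtain ⟨P, hP, e, he, rfl⟩ := mem_assembleOn_edges.1 hd
    obtain ⟨q, hq, rfl⟩ := List.mem_map.1 hpd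
    exact ⟨P, hP, P.box_shift.2 (((H.valid P hP).edge he).2.2.2.2.2.2.2 q hq).1⟩

end assembleOnW

end Literature.Barriers.CriticalPhenomena.GridSAW
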